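import Mathlib
import HarnessLib
import Literature.AlgebraicGeometry.Surfaces.K3Surface
import Literature.AlgebraicGeometry.Surfaces.K3PeriodSurjectivity
import Literature.AlgebraicGeometry.Hyperkaehler.OGradySixType
import Literature.AlgebraicGeometry.HodgeTheory.ChernCharacterBetti
import Literature.AlgebraicGeometry.Surfaces.PolarisedK3TwinKuranishiFamily

/-!
# Crux `NikulinTwinTransport.TwinTwistorTransport` (stmt-HodgeConjecture-14393): objects of the
# line `mukai-lift-full-similitude`

Definitions (no stub statements, no named facts) used by the positive-side files of this crux for
the line `mukai-lift-full-similitude`, i.e. by the registered stubs of the checked skeleton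
`Cruxes/TwinTwistorTransport/Lines/mukai_lift_full_similitude.lean` (crux-plan
planner-cruxplan-stmt-HodgeConjecture-14393-mukai-lift-full-simi-0; lead
prover-line-stmt-HodgeConjecture-14393-1) and by its composition theorem `TwinTwistorTransport_of`.
Statements are VERBATIM those of the planner's checked skeleton (vocabulary sections "K3 side",
"Mukai-lift side", "hyperkähler side"); they are moved here so that stub files under `Theorems/`
can import them (a `Theorems` file may not import a `Cruxes` work file), exactly as
`Theorems/PadicSemiregularLiftSemiregularSeedsOnAnchorsDefs.lean` does for its crux.

* §1 K3 side (marked projective K3 surfaces are the Literature predicate `IsMarkedK3`, imported):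
  `PeriodPt`, `IsRatEnd`, `IsTwoSimilitudePair`, the
  correspondence action `corrH2` (`[γ]_* y = fst_*(snd^* y ∪ γ)` between smooth projective
  varieties of any dimensions) and `TwinAlg` (the conclusion of `TwinTransportFor[M]` verbatim).
* §2 Mukai-lift side: the lattice `LiftLat = Λ_ℂ ⊕ ℂδ`, the Beauville–Bogomolov forms
  `liftForm n = Λ ⊕ ⟨−2(n−1)⟩`, the lift `liftEnd M = M ⊕ id` with its kernel-checked first
  lemmas (`liftForm_liftEnd`: the lift of a `2`-similitude of `Λ` is a `2`-similitude
  `(Λ ⊕ ⟨−2⟩)(2) → Λ ⊕ ⟨−4⟩`; rationality `liftEnd_ofZL`), the period domain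
  `liftPeriodDomain n`, positive / generic three-spaces, twistor lines and the elementary step
  `OnCommonGenericLiftLine n` (Huybrechts Ch. 7 §3.1 for the lattice `Λ ⊕ ⟨−2(n−1)⟩`,
  Markman 2024 Def. 5.13).
* §3 hyperkähler side: `MarkedHK` (marked numerically-`K3^{[n]}` projective irreducible
  symplectic `2n`-fold with the Fujiki relation), Hilbert-type links `IsHilbLink`, and
  `LiftAlg` ("the Mukai lift is algebraic at a marked pair").
The six registered stub STATEMENTS (`HilbertPackage`, `NikulinAnchor`, `LiftIffTwin`,
`TwistorReach`, `LiftEngine`, `K3MarkingExists`) are NOT restated here: each stub file states its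
registered signature over this vocabulary directly, and the skeleton keeps the named `Prop`s for
its composition (so a reshaped stub never freezes a dead statement in this append-only file).

Sources: A. Beauville, J. Differential Geom. 18 (1983) §6–§9 (`H²(S^{[n]}, ℤ) = H²(S, ℤ) ⊕ ℤδ`,
`q(δ) = −2(n−1)`); D. Huybrechts, *Lectures on K3 Surfaces* (CUP 2016) Ch. 6 §1.1, Ch. 7 §3.1
(period domain, positive / generic three-spaces, twistor lines); E. Markman, *Rational Hodge
isometries of hyper-Kähler varieties of K3^{[n]} type are algebraic*, Compos. Math. 160 (2024)
(arXiv:2204.00516) Def. 5.13; W. Fulton, *Intersection Theory* §16.1 (correspondences).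
-/

-- `Summit.HodgeConjecture.HodgeConjecture.…` (summit = problem) duplicates a namespace component by design (D-0017).
set_option linter.dupNamespace false

noncomputable section

namespace Summit.HodgeConjecture.HodgeConjecture.Theorems.TwinTwistorTransport.MukaiLift

open CategoryTheory MonoidalCategory
open scoped Manifold BigOperators
open Literature.AlgebraicGeometry.Motives Literature.AlgebraicGeometry.HodgeTheory
open Literature.AlgebraicGeometry.Surfaces Literature.AlgebraicGeometry.Hyperkaehler
open Literature.AlgebraicTopology.SingularHomology

/-! ## Vocabulary, K3 side (shapes VERBATIM those of `Theorems.NikulinTwinTransport`: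
`MarkedK3[S, η, p, x]` = the Literature predicate `IsMarkedK3 S η p x` (used directly), `PeriodPt[x]`,
the conclusion of `TwinTransportFor[M]`) -/

/-- Projective period point: `(x.x) = 0`, `(x̄.x) > 0`, and a positive lattice vector orthogonal to
`x` — the shape `PeriodPt[x]` (hypotheses of `Huybrechts_K3_periodSurjective_projective`). [cite: Huybrechts2016K3, Ch. 6 §1.1 and Rem. 3.3] -/
def PeriodPt (x : K3Index → ℂ) : Prop :=
  k3Form x x = 0 ∧ 0 < (k3Form (star x) x).re ∧
    ∃ u : K3Index → ℤ, k3Form (fun i => (u i : ℂ)) x = 0 ∧ 0 < ∑ i, ∑ j, u i * k3Gram i j * u j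

/-- Endomorphism of `Λ_ℂ` defined over `ℚ`. [folklore] -/
def IsRatEnd (M : Module.End ℂ (K3Index → ℂ)) : Prop :=
  ∀ v : K3Index → ℤ, ∃ w : K3Index → ℚ, M (fun i => (v i : ℂ)) = fun i => (w i : ℂ)

/-- A rational `2`-similitude `M` of `(Λ_ℂ, k3Form)` with rational two-sided inverse `N` — the
lattice hypotheses of `twinTwistorTransport_of_twinTransport`, in this order. [folklore] -/
def IsTwoSimilitudePair (M N : Module.End ℂ (K3Index → ℂ)) : Prop :=
  IsRatEnd M ∧ IsRatEnd N ∧ M * N = 1 ∧ N * M = 1 ∧ ∀ a b, k3Form (M a) (M b) = 2 * k3Form a b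

/-- `[γ]_* y := fst_* (snd^* y ∪ γ) : H²(B(ℂ); ℂ) → H²(A(ℂ); ℂ)` — the action on `H²` of a class
`γ ∈ H^{2·dim B}((A × B)(ℂ); ℂ)` (a degree-`0` correspondence from `B` to `A`) between smooth
projective varieties of dimensions `a`, `b`.  For `a = b = 2` it is the expression `Corr[…]` of the
route items (up to the proof term of the degree identity). [cite: Fulton1998, §16.1 Def. 16.1.2] -/
abbrev corrH2 (μ : OrientationFamily) (A B : SchemeOver ℂ) (a b : ℕ) (hA : IsSmoothProjective a A)
    (hB : IsSmoothProjective b B) (γ : complexBetti (A ⊗ B) (2 * b)) (y : complexBetti B (2 * 1)) :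
    complexBetti A (2 * 1) :=
  complexGysin μ (IsSmoothProjective.tensor_holds hA hB) hA (SemiCartesianMonoidalCategory.fst A B)
    (show 2 * 1 + 2 * b + 2 * a = 2 * 1 + 2 * (a + b) by ring)
    (cupProduct (rfl : 2 * 1 + 2 * b = 2 * 1 + 2 * b)
      (complexBetti.map (SemiCartesianMonoidalCategory.snd A B) (2 * 1) y) γ)

/-- "The twin similitude `η⁻¹ ∘ M ∘ η′` of the marked K3 pair is `[γ]_*` for an algebraic `γ` on
`S × S′`" — VERBATIM the conclusion of `TwinTransportFor[M]`. [folklore] -/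
def TwinAlg (M : Module.End ℂ (K3Index → ℂ)) (μ : OrientationFamily) (S S' : SchemeOver ℂ)
    (hS : IsK3Surface S) (hS' : IsK3Surface S') (η : complexBetti S (2 * 1) ≃ₗ[ℂ] (K3Index → ℂ))
    (η' : complexBetti S' (2 * 1) ≃ₗ[ℂ] (K3Index → ℂ)) : Prop :=
  ∃ γ ∈ algebraicClasses (S ⊗ S') 2, ∀ y : complexBetti S' (2 * 1),
    η.symm (M (η' y)) =
      complexGysin μ
        (IsSmoothProjective.tensor_holds (IsK3Surface.isSmoothProjective hS)
          (IsK3Surface.isSmoothProjective hS'))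
        (IsK3Surface.isSmoothProjective hS) (SemiCartesianMonoidalCategory.fst S S')
        (rfl : 2 * 1 + 2 * 2 + 2 * 2 = 2 * 1 + 2 * (2 + 2))
        (cupProduct (rfl : 2 * 1 + 2 * 2 = 2 * 1 + 2 * 2)
          (complexBetti.map (SemiCartesianMonoidalCategory.snd S S') (2 * 1) y) γ)

/-! ## Vocabulary, Mukai-lift side: the lattice `L = Λ_ℂ ⊕ ℂδ`, its forms `q_n = Λ ⊕ ⟨−2(n−1)⟩`,
the lift `M̃ = M ⊕ id`, and the PROVED first lemma of the card (the lift is a `2`-similitude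
`(L, q₂) → (L, q₃)` fixing `δ`, rational with rational inverse) -/

/-- `L = Λ_ℂ ⊕ ℂδ`: the marked second cohomology of `S^{[n]}` (`n ≥ 2`):
`H²(S^{[n]}, ℤ) = i(H²(S, ℤ)) ⊕ ℤδ`, `2δ = [E]` the exceptional divisor (Beauville 1983 §6). [cite: Beauville1983, §6] -/
abbrev LiftLat : Type := (K3Index → ℂ) × ℂ

/-- The Beauville–Bogomolov form of `K3^{[n]}`-type in the marking `L`: `Λ_{K3} ⊕ ⟨−2(n−1)⟩`,
`q_n((u, a), (v, b)) = (u.v) − 2(n−1)·ab` (`q(δ) = −2(n−1)`). [cite: Beauville1983, §6 and §9] -/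
def liftForm (n : ℕ) (u v : LiftLat) : ℂ := k3Form u.1 v.1 - (2 * (n : ℂ) - 2) * (u.2 * v.2)

/-- THE MUKAI LIFT of an endomorphism `M` of `Λ_ℂ`: `M̃ := M ⊕ id` on `L = Λ_ℂ ⊕ ℂδ` (`δ ↦ δ`) — the
restriction to `w^⊥ → v^⊥` of `Ψ̃(r, x, s) = (r, Ψx, 2s)` for `w = (1,0,−1) ↦ v = (1,0,−2)`, read in
the bases `δ₂ = (1,0,1)`, `δ₃ = (1,0,2)`. [folklore] -/
def liftEnd (M : Module.End ℂ (K3Index → ℂ)) : Module.End ℂ LiftLat := M.prodMap LinearMap.id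

/-- Image in `L` of a lattice vector `(v, k) ∈ Λ ⊕ ℤδ`. [folklore] -/
def ofZL (v : K3Index → ℤ) (k : ℤ) : LiftLat := (fun i => (v i : ℂ), (k : ℂ))

/-- Image in `L` of a real vector of `Λ_ℝ ⊕ ℝδ`. [folklore] -/
def ofRL (w : (K3Index → ℝ) × ℝ) : LiftLat := (fun i => (w.1 i : ℂ), (w.2 : ℂ))

/-- Real part of a vector of `L`. [folklore] -/
def reL (x : LiftLat) : (K3Index → ℝ) × ℝ := (fun i => (x.1 i).re, x.2.re)

/-- Imaginary part of a vector of `L`. [folklore] -/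
def imL (x : LiftLat) : (K3Index → ℝ) × ℝ := (fun i => (x.1 i).im, x.2.im)

/-- Unfolding of the lift on a vector. [folklore] -/
@[simp] theorem liftEnd_apply (M : Module.End ℂ (K3Index → ℂ)) (x : LiftLat) :
    liftEnd M x = (M x.1, x.2) := rfl

/-- **First lemma of the card, kernel-checked: the Mukai lift of a `2`-similitude of `Λ` is a
`2`-similitude `(Λ ⊕ ⟨−2⟩)(2) → Λ ⊕ ⟨−4⟩`** (`q₃(M̃u, M̃v) = 2·q₂(u, v)`: on `Λ` the factor `2` of
`M`, on `δ` the identity with `−4 = 2·(−2)`).  This is `ψ̃ : H²(S″^{[2]}) → H²(S^{[3]})`,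
`δ₂ ↦ δ₃`, in markings. [folklore] -/
theorem liftForm_liftEnd (M : Module.End ℂ (K3Index → ℂ))
    (hM2 : ∀ a b, k3Form (M a) (M b) = 2 * k3Form a b) (u v : LiftLat) :
    liftForm 3 (liftEnd M u) (liftEnd M v) = 2 * liftForm 2 u v := by
  simp only [liftForm, liftEnd_apply, hM2]
  push_cast
  ring

/-- **Registered sub-goal `mukaiLift_isTwoSimilitude`** (the card's first lemma, closed form of
`liftForm_liftEnd`): the Mukai lift `M ⊕ id` of a `2`-similitude `M` of `Λ_ℂ` is a `2`-similitude
`(Λ ⊕ ⟨−2⟩)(2) → Λ ⊕ ⟨−4⟩`, i.e. `q₃(M̃u, M̃v) = 2·q₂(u, v)` for all `u, v ∈ L`. [folklore] -/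
theorem mukaiLift_isTwoSimilitude : ∀ (M : Module.End ℂ (K3Index → ℂ)), (∀ a b, k3Form (M a) (M b) = 2 * k3Form a b) → ∀ u v : LiftLat, liftForm 3 (liftEnd M u) (liftEnd M v) = 2 * liftForm 2 u v :=
  fun M hM2 u v => liftForm_liftEnd M hM2 u v

/-- The lift fixes `δ = (0, 1)`. [folklore] -/
theorem liftEnd_delta (M : Module.End ℂ (K3Index → ℂ)) : liftEnd M (0, 1) = (0, 1) := by
  simp

/-- The lift restricts to `M` on `Λ_ℂ = L ∩ {δ-coordinate 0}`; in particular matched K3 periods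
`M x′ = t·x` give matched lifted periods `M̃(x′, 0) = t·(x, 0)`. [folklore] -/
theorem liftEnd_inl_smul {M : Module.End ℂ (K3Index → ℂ)} {x x' : K3Index → ℂ} {t : ℂ}
    (h : M x' = t • x) : liftEnd M (x', 0) = t • ((x, 0) : LiftLat) := by
  simp [h]

/-- Lifts compose: `M̃ Ñ = (MN)~`. [folklore] -/
theorem liftEnd_mul (M N : Module.End ℂ (K3Index → ℂ)) :
    liftEnd M * liftEnd N = liftEnd (M * N) := by
  refine LinearMap.ext fun x => ?_
  simp [Module.End.mul_apply]

/-- The lift of the identity is the identity. [folklore] -/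
theorem liftEnd_one : liftEnd (1 : Module.End ℂ (K3Index → ℂ)) = 1 := by
  refine LinearMap.ext fun x => ?_
  simp

/-- A two-sided inverse lifts to a two-sided inverse: `M N = 1 ⟹ M̃ Ñ = 1`. [folklore] -/
theorem liftEnd_mul_eq_one {M N : Module.End ℂ (K3Index → ℂ)} (h : M * N = 1) :
    liftEnd M * liftEnd N = 1 := by
  rw [liftEnd_mul, h, liftEnd_one]

/-- The lift of an endomorphism defined over `ℚ` is defined over `ℚ` on `Λ ⊕ ℤδ` (so the lifted
similitude `θ⁻¹ ∘ M̃ ∘ θ′` is RATIONAL — clause (R) one level up, never a `ℂ`-multiple of an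
isometry; Disproof T1/T1′). [folklore] -/
theorem liftEnd_ofZL {M : Module.End ℂ (K3Index → ℂ)} (hM : IsRatEnd M) (v : K3Index → ℤ) (k : ℤ) :
    ∃ (w : K3Index → ℚ) (l : ℚ), liftEnd M (ofZL v k) = (fun i => (w i : ℂ), (l : ℂ)) := by
  obtain ⟨w, hw⟩ := hM v
  refine ⟨w, k, ?_⟩
  simp [ofZL, hw]

/-! ### Period domain and generic twistor lines of `(L, q_n)` (the pattern of `K3TwistorLines`,
Huybrechts Ch. 6 §1.1 and Ch. 7 §3.1, for the lattice `Λ ⊕ ⟨−2(n−1)⟩` of signature `(3, 20)`) -/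

/-- Period domain of `(L, q_n)`: `q_n(x) = 0`, `q_n(x̄, x) > 0`. [cite: Huybrechts2016K3, Ch. 6 §1.1] -/
def liftPeriodDomain (n : ℕ) : Set LiftLat :=
  {x | liftForm n x x = 0 ∧ 0 < (liftForm n (star x) x).re}

/-- Positive three-space `W ⊂ L_ℝ` for `q_n`. [cite: Huybrechts2016K3, Ch. 7 §3.1] -/
def IsLiftPositiveThreeSpace (n : ℕ) (W : Submodule ℝ ((K3Index → ℝ) × ℝ)) : Prop :=
  Module.finrank ℝ W = 3 ∧ ∀ w ∈ W, w ≠ 0 → 0 < (liftForm n (ofRL w) (ofRL w)).re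

/-- Generic three-space: `W^⊥ ∩ (Λ ⊕ ℤδ) = 0` (Huybrechts Ch. 7 §3.1; Markman 2024 Def. 5.13). [cite: Huybrechts2016K3, Ch. 7 §3.1] -/
def IsLiftGenericThreeSpace (n : ℕ) (W : Submodule ℝ ((K3Index → ℝ) × ℝ)) : Prop :=
  ∀ (v : K3Index → ℤ) (k : ℤ), (∀ w ∈ W, liftForm n (ofZL v k) (ofRL w) = 0) → v = 0 ∧ k = 0

/-- The twistor line `T_W = D ∩ ℙ(W_ℂ)` of `W`, as a set of representing vectors. [cite: Huybrechts2016K3, Ch. 7 §3.1] -/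
def liftTwistorLine (n : ℕ) (W : Submodule ℝ ((K3Index → ℝ) × ℝ)) : Set LiftLat :=
  {x | x ∈ liftPeriodDomain n ∧ reL x ∈ W ∧ imL x ∈ W}

/-- "`x` and `y` lie on a common GENERIC twistor line of `(L, q_n)`". [cite: Huybrechts2016K3, Ch. 7 §3.1 Def. 3.1] -/
def OnCommonGenericLiftLine (n : ℕ) (x y : LiftLat) : Prop :=
  ∃ W : Submodule ℝ ((K3Index → ℝ) × ℝ), IsLiftPositiveThreeSpace n W ∧ IsLiftGenericThreeSpace n W ∧
    x ∈ liftTwistorLine n W ∧ y ∈ liftTwistorLine n W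

/-- A projective K3 period `x` gives the period `(x, 0)` of `(L, q_n)` for every `n`
(`H^{2,0}(S^{[n]}) = i(H^{2,0}(S))`). [folklore] -/
theorem mem_liftPeriodDomain_of_periodPt (n : ℕ) {x : K3Index → ℂ} (hx : PeriodPt x) :
    ((x, 0) : LiftLat) ∈ liftPeriodDomain n := by
  refine ⟨?_, ?_⟩
  · simp [liftForm, hx.1]
  · simpa [liftForm, Prod.star_def] using hx.2.1

/-! ## Vocabulary, hyperkähler side: numerically-`K3^{[n]}` marked projective irreducible symplectic
varieties, Hilbert-type links, and "the lift is algebraic" -/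

/-- **Marked numerically-`K3^{[n]}` projective irreducible symplectic `2n`-fold with period `z`**:
`X` is projective irreducible holomorphic symplectic of dimension `2n` (`IsProjectiveIrreducibleSymplectic`),
`pX` generates the integral classes of `H^{4n}`, the marking `θ : H²(X(ℂ); ℂ) ≅ L` identifies integral
classes with `Λ ⊕ ℤδ`, the FUJIKI RELATION `a^{2n} = (2n−1)!!·q_n(θa)^n·pX` holds (so `q_n ∘ θ` is the
Beauville–Bogomolov form and the Fujiki constant is that of `K3^{[n]}`: `3` for `n = 2`, `15` for
`n = 3`), and `θ⁻¹ z` spans the `(2,0)`-classes.  Intended instances: `S^{[n]}` with the marking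
`i ∘ η ⊕ (δ ↦ (0,1))` and every projective deformation of it with a parallel-transported marking. [cite: Beauville1983, §6–§9] -/
def MarkedHK (n : ℕ) (X : SchemeOver ℂ) (θ : complexBetti X (2 * 1) ≃ₗ[ℂ] LiftLat)
    (pX : complexBetti X (2 * (2 * n))) (z : LiftLat) : Prop :=
  IsProjectiveIrreducibleSymplectic (2 * n) X ∧
    (IsIntegralClass pX ∧ ∀ q : complexBetti X (2 * (2 * n)), IsIntegralClass q → ∃ k : ℤ, q = k • pX) ∧
    (∀ c : complexBetti X (2 * 1), IsIntegralClass c ↔ ∃ (v : K3Index → ℤ) (k : ℤ), θ c = ofZL v k) ∧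
    (∀ a : complexBetti X (2 * 1),
        cupPowTwo a (2 * n) = ((Nat.doubleFactorial (2 * n - 1) : ℂ) * liftForm n (θ a) (θ a) ^ n) • pX) ∧
    IsOfHodgeType (2 * n) X (2 * 1) 2 0 (θ.symm z) ∧
    (∀ τ : complexBetti X (2 * 1), IsOfHodgeType (2 * n) X (2 * 1) 2 0 τ → ∃ t : ℂ, τ = t • θ.symm z)

/-- **Hilbert-type LINK** between a marked surface `(S, η)` and a marked `2n`-fold `(X, θ, pX)`:
`i := [ι]_* : H²(S) → H²(X)` is the marked inclusion `θ(i a) = (η a, 0)`; `r := [ρ]_* : H²(X) → H²(S)`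
is `c·(Λ-coordinate)`, `c ≠ 0` (so `r ∘ i = c·id` and `r δ = 0`); `δ := θ⁻¹(0, 1)` is algebraic; and the
`δ`-coordinate is cup product with an algebraic class `ζ`: `b ∪ ζ = (θ b)₂·pX`.  Instance
`X = S^{[n]}`: `ι = [Ξ_n]` (universal family), `ρ ∝ [Ξ_n]ᵗ ∪ pr_X^*δ^{2n−2}`, `ζ ∝ δ^{2n−1}`, `2δ = [E]`
— the constants are non-zero by the polarised Fujiki relation (`∫ i(a) i(b) δ^{2n−2} ∝ (a.b)·q(δ)^{n−1}`,
`∫ i(a) δ^{2n−1} = 0`, `∫ δ^{2n} = c_n q(δ)^n ≠ 0`). [cite: Beauville1983, §6] -/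
def IsHilbLink (n : ℕ) (μ : OrientationFamily) (S X : SchemeOver ℂ) (hS : IsSmoothProjective 2 S)
    (hX : IsSmoothProjective (2 * n) X) (η : complexBetti S (2 * 1) ≃ₗ[ℂ] (K3Index → ℂ))
    (θ : complexBetti X (2 * 1) ≃ₗ[ℂ] LiftLat) (pX : complexBetti X (2 * (2 * n)))
    (ι : complexBetti (X ⊗ S) (2 * 2)) (ρ : complexBetti (S ⊗ X) (2 * (2 * n))) (c : ℂ) : Prop :=
  ι ∈ algebraicClasses (X ⊗ S) 2 ∧ ρ ∈ algebraicClasses (S ⊗ X) (2 * n) ∧ c ≠ 0 ∧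
    (∀ a : complexBetti S (2 * 1), θ (corrH2 μ X S (2 * n) 2 hX hS ι a) = (η a, 0)) ∧
    (∀ b : complexBetti X (2 * 1), η (corrH2 μ S X 2 (2 * n) hS hX ρ b) = c • (θ b).1) ∧
    θ.symm (0, 1) ∈ algebraicClasses X 1 ∧
    ∃ (m : ℕ) (hm : 2 * 1 + 2 * m = 2 * (2 * n)) (ζ : complexBetti X (2 * m)),
      ζ ∈ algebraicClasses X m ∧ ∀ b : complexBetti X (2 * 1), cupProduct hm b ζ = (θ b).2 • pX

/-- **"The Mukai lift is algebraic at the marked pair `(X, θ)`, `(X′, θ′)`"**: the lifted similitude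
`θ⁻¹ ∘ M̃ ∘ θ′ : H²(X′(ℂ); ℂ) → H²(X(ℂ); ℂ)` (`dim X = 6`, `dim X′ = 4`) is `[γ]_*` for an algebraic
class `γ` of codimension `4` on `X × X′` — the statement C⁺ of the card at one pair. [folklore] -/
def LiftAlg (M : Module.End ℂ (K3Index → ℂ)) (μ : OrientationFamily) (X X' : SchemeOver ℂ)
    (hX : IsSmoothProjective (2 * 3) X) (hX' : IsSmoothProjective (2 * 2) X')
    (θ : complexBetti X (2 * 1) ≃ₗ[ℂ] LiftLat) (θ' : complexBetti X' (2 * 1) ≃ₗ[ℂ] LiftLat) : Prop :=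
  ∃ γ ∈ algebraicClasses (X ⊗ X') (2 * 2), ∀ y : complexBetti X' (2 * 1),
    θ.symm (liftEnd M (θ' y)) = corrH2 μ X X' (2 * 3) (2 * 2) hX hX' γ y

end Summit.HodgeConjecture.HodgeConjecture.Theorems.TwinTwistorTransport.MukaiLift

end
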